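import Mathlib
import HarnessLib
import HarnessLib.Audit
import Summits.AtomisticToContinuum.Statement

/-!
Route: HomoenergeticRung

CLOSED (retired) 2026-08-15T13:43:16Z by operator:999:1257524 — reason: not-a-thesis: assembly does not conclude the sub-problem Statement — note: D-0027 §2.1 audit (human 2026-08-15: routes that do not decide the summit are removed): the assembly concludes `FrozenRung`, not the sub-problem statement; a NEW conforming route may be opened from the same idea (generated `closes : … → _root_.HydrodynamicLimit`).. The file is kept as the record of this route; refuted decls are indexed as negative knowledge (`ledger negatives`).

# Route HomoenergeticRung — Objective-MD rung — homogeneous hard spheres at Euler scaling: one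
tensor isotropises, collisions run the EOS clock, homogeneous deformation heats along the adiabat

ANALOGUE RUNG (declared; precedent SabraStatics / Parity-CubicRoots: the Assembly closes the rung
target, frame #1 "rung → HydrodynamicLimit" is NOT claimed). Realises card
homoenergetic-objective-md-rung. X = X₀ ∧ X_A.
X₀ (typed, decl FrozenRung = FrozenCoercivity-part ∧ ContactThermalisation-part): the SPATIALLY
HOMOGENEOUS hard-sphere gas on 𝕋³ at the conjunct's scaling (N+1 spheres of diameter σ(N+1)^{-1/3},
any HardSphereFlow, N → ∞ at fixed small σ) started from hard-core-uniform positions × an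
ANISOTROPIC centred Gaussian velocity law (temperatures θ₀, θ₁, θ₂ along the axes) is, at every
macroscopic time t > 0, the equilibrium fluid at θ̄ = (θ₀+θ₁+θ₂)/3 in the two senses the Euler
closure uses: (K) the empirical kinetic tensor N⁻¹Σᵢ vᵢ⊗vᵢ → θ̄·𝟙 in probability (zero Euler-order
normal-stress differences), and (P) the collisional virial rate over any window [t, t+τ] — ε_N
Σ_{collisions} Σᵢ‖Δvᵢ‖ /(6 θ̄ τ (N+1)) — → Z(σ³) − 1 in probability, Z = hsCompressibility: the
hard-sphere EQUATION OF STATE read off the collision process, not off the partition function.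
X_A (informal until the definition request ObjectiveHardSphereFlow lands; decl HomoenergeticAdiabat,
filed after open): the same gas in the Dayal–James objective-MD cell ℝ³/(I+tA)ℤ³ — an exact
wall-free invariant manifold of Newtonian dynamics realising the homoenergetic Euler flow u =
A(I+tA)⁻¹x, ρ(t) = ρ₀/det(I+tA) — started from canonical Gibbs data keeps, for t < t*(A), Maxwellian
peculiar velocities at the ADIABATIC temperature d log θ/dt = −(2/3) Z(ρ(t)σ³) tr(A(I+tA)⁻¹): zero
Euler-order viscous heating. X₀ is the A = 0 tangent of X_A (d/dA at A = 0 of the heating identity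
is exactly (P); (K) is the coercivity X_A consumes, with the anisotropy put in the data instead of
the driving).
Lean: `open Literature.MathematicalPhysics.KineticTheory Literature.Analysis.FluidPDE MeasureTheory
Filter Topology in ∃ σ₀ : ℝ, 0 < σ₀ ∧ ∀ σ : ℝ, 0 < σ → σ < σ₀ → ∀ θ : Fin 3 → ℝ, (∀ k, 0 < θ k) → ∀
Φ : (N : ℕ) → HardSphereFlow (Torus.geometry (Fin 3)) (hsDiameter σ N) (N + 1), let P : (N : ℕ) →
Measure (Config (N + 1) (Fin 3) T3) := fun N => particleLaw (Φ N) (canonicalDensity (Torus.geometry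
(Fin 3)) (hsDiameter σ N) (N + 1) (fun y => Real.exp (-(∑ k, (y.2 k) ^ 2 / (2 * θ k))))); (∀ N,
IsProbabilityMeasure (P N)) ∧ ∀ t : ℝ, 0 < t → (∀ (k l : Fin 3) (δ : ℝ), 0 < δ → Tendsto (fun N => P
N {z | δ < |(∫ y, y.2 k * y.2 l ∂(empiricalMeasure ((Φ N).flow t z))) - (if k = l then (θ 0 + θ 1 +
θ 2) / 3 else 0)|}) atTop (𝓝 0)) ∧ (∀ τ : ℝ, 0 < τ → ∀ δ : ℝ, 0 < δ → Tendsto (fun N => P N {z | δ <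
|hsDiameter σ N / (6 * ((θ 0 + θ 1 + θ 2) / 3) * τ * ((N : ℝ) + 1)) * (∑ᶠ s ∈ collisionTimes
(Torus.geometry (Fin 3)) (hsDiameter σ N) (fun r => (Φ N).flow r z) ∩ Set.Icc t (t + τ), ∑ i, ‖((Φ
N).flow s z i).2 - (Function.leftLim (fun r => (Φ N).flow r z) s i).2‖) - (hsCompressibility (σ ^ 3)
- 1)|}) atTop (𝓝 0))`

## Assembly
Pure logic: FrozenCoercivity and ContactThermalisation share the quantifier prefix and the let-bound
law P; take σ₀ := min of the two σ₀, the probability-measure clause from either, (K) from the first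
and (P) from the second — PROVED in the planner's Sketch.lean (theorem assembly_holds, 8 lines, lean
check rc 0). The route is an analogue rung: FrozenRung does not imply
Literature.MathematicalPhysics.KineticTheory.HydrodynamicLimit (anisotropic velocity data are not
local Gibbs data; affine velocity fields do not live on 𝕋³) and no item claims it. Bearing on the
conjunct, recorded not claimed: (a) any proof of FluxClosure-type cruxes (0823; stiff-relaxation K1;
WarmAnisotropyRare) proves FrozenCoercivity first — it is their translation-invariant instance and
the cheapest place to be refuted; (b) VirialEOS/ContactThermalisation identify the pressure p =
ρθZ(ρσ³) from the collision process, the dynamical counterpart of PressureFunctional (3333) /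
HsEosLowDensity (0768) that every closure needs; (c) HomoenergeticAdiabat (X_A) is what
HydrodynamicLimit predicts for zoomed locally-affine data (FirstFailureBlowup's
SmallDataHydrodynamics 3332 in the affine class): order-one viscous heating at Euler scaling for
some A would be evidence against the conjunct at that σ.

Rationale: WHY THIS LINE. Objective MD (DayalJames2010) makes every homoenergetic flow an exact invariant
manifold of the infinite hard-sphere system, so on it the Euler limit loses all transport, profiles,
boundaries and block estimates and keeps exactly its thermodynamic content: isotropy of ONE 3×3
tensor and the equation of state entering through the collision process; JamesNotaVelazquez2019
prove the kinetic analogue (collision-dominated homoenergetic Boltzmann solutions stay Maxwellian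
with a time-dependent temperature), and sixty years of NEMD (SLLOD / Lees–Edwards /
KraynikReinelt1992 cells; Erpenbeck1984, EvansMorriss2008) measure precisely these quantities. The
typed spine X₀ is the A = 0 member stated on the conjunct's own objects (HardSphereFlow,
canonicalDensity, empiricalMeasure, collisionTimes, hsCompressibility): FrozenCoercivity is the
translation-invariant core of every flux-closure crux on the board (FluxClosure 0823; the
stiff-relaxation / warm-isotropises / maxwellian-clt cards state cellwise or large-deviation
versions), and VirialEOS/ContactThermalisation are the DYNAMICAL face of p = ρθZ(ρσ³)
(ErpenbeckWood1984's MD observable; the static face is PressureFunctional 3333 / HsEosLowDensity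
0768), provable-with-work from canonical cluster expansions (PulvirentiTsagkarogiannis2012,
LebowitzPenrose1964) plus stationarity and sub-mean-free-time locality. Imported areas: continuum
mechanics of objective structures (Dayal–James), kinetic theory of homoenergetic flows
(Truesdell–Galkin–JNV), equilibrium statistical mechanics (contact/virial theorem), and the
passivity theorem of PuszWoronowicz1978 (the sign in PassiveHeating). No prior route or negative
(index empty) touches homogeneous relaxation or the collisional virial; the new routes
FirstFailureBlowup (zoom to near-constant data) and OneParticleInfluence (HomogeneousInvariance
3073, shared here) are the natural consumers.

RANKED CRUXES. #0 FrozenRung (target) — X₀ above: for σ < σ₀, every axis temperature vector θ > 0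
and every family of hard-sphere flows, the laws P_N = particleLaw(canonicalDensity of 𝟙_{hard
core}·∏ exp(−v_k²/2θ_k)) are probability measures and for every t > 0: (K) all entries of the
empirical kinetic tensor at time t converge in probability to θ̄δ_kl, and (P) for every τ > 0 the
normalised collisional virial over [t, t+τ] converges in probability to hsCompressibility(σ³) − 1.
(why it might fail: Conjunction of FrozenCoercivity and ContactThermalisation, fails with either;
also the target value hsCompressibility = 1 + η·deriv f_ex (limsup/deriv junk) is the honest Z only
where f_ex is differentiable — expected at all small σ (LebowitzPenrose1964) but part of the claim.)
[DayalJames2010, JamesNotaVelazquez2019, ErpenbeckWood1984, Spohn1991]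
#2 FrozenCoercivity (crux) — (K) alone — ONE-TENSOR COERCIVITY, frozen (A = 0) form of the card's
crux E2: from hard-core-uniform positions × anisotropic Gaussian velocities (θ₀,θ₁,θ₂), at fixed
reduced density σ < σ₀ and every macroscopic t > 0, N⁻¹Σᵢ v_{i,k}v_{i,l}(t) → θ̄δ_kl in probability,
θ̄ = (θ₀+θ₁+θ₂)/3 (collisions destroy velocity anisotropy at rate ≍ N^{1/3}; the ideal gas σ = 0 is
the exact counterexample: the anisotropic state is stationary under free flight, BoltzmannHypothesis
kernel). [difficulty: open-problem] (why it might fail: Needs control of deterministic hard spheres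
at FIXED reduced density over ≍N^{1/3}t collision times; not even one mean free time is covered by a
Lanford-type theorem there (DiluteRegimeBarrier). False if a positive-measure anisotropy-keeping
class (lanes/rows) is reachable from Gibbs positions.) [Spohn1991, JamesNotaVelazquez2019, GST2013,
BGSSCPAM2023, Literature.Barriers.AtomisticToContinuum.BoltzmannHypothesisBarrierNarrow,
Literature.Barriers.AtomisticToContinuum.DiluteRegimeBarrierNarrow]
#3 ContactThermalisation (crux) — (P) for the same anisotropic data — after any t > 0 the two-body
CONTACT statistics are the equilibrium ones at (σ, θ̄): the collisional virial ε_N Σ_{s ∈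
collisionTimes ∩ [t,t+τ]} Σᵢ ‖vᵢ(s) − vᵢ(s⁻)‖ /(6 θ̄ τ (N+1)) → Z(σ³) − 1 in probability (collision
rate = Enskog rate 4nε²χ√(πθ̄) with χ = 3(Z−1)/(2πσ³) AND mean impulse √(πθ̄) per collision); frozen
form of the card's "collisional pressure takes its local-equilibrium value", i.e. zero Euler-order
bulk-viscous pressure excess. [deps: FrozenCoercivity] [difficulty: open-problem] (why it might
fail: A two-body contact statistic: needs the pair law at contact (rate ∝ χ(σ³), Maxwellian flux
impulse law at θ̄), strictly more than one-body isotropy; at fixed σ excluded-volume correlations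
built during relaxation could leave an O(1) non-equilibrium contact density (history-dependent
collision rate).) [ErpenbeckWood1984, VanbeijerenErnst1973, Resibois1978, Spohn1991,
EvansMorriss2008]
#9 VirialEOS (support) — The θ₀ = θ₁ = θ₂ (canonical Gibbs, localGibbsLaw with constant profiles 1,
0, θ) case of (P) from time 0: under the flow-invariant equilibrium law the normalised collisional
virial over [0,T] converges in probability to hsCompressibility(σ³) − 1 — the virial/contact theorem
realised DYNAMICALLY (ErpenbeckWood1984's MD estimator of Z as a theorem). Intended proof: (i)
finite-N scaling identity ∂_ε log(free volume) = −(contact surface measure) and canonical cluster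
expansion uniform in N (PulvirentiTsagkarogiannis2012) ⇒ contact value → 3(Z−1)/(2πσ³) with Z = 1 +
η f_ex′(η) analytic at small η (LebowitzPenrose1964, Ruelle1969 §3.4); (ii) E[virial] exact by
stationarity (HomogeneousInvariance) + Rice/flux formula on the contact set; (iii) variance: slice
[0,T] into windows h_N with N^{-4/3} ≪ h_N ≪ N^{-1/3}; Cauchy–Schwarz across windows reduces to the
relative variance of ONE sub-mean-free-time window, where collision events are local functionals of
the initial Gibbs configuration up to geometrically small collision-chain corrections ⇒ Poisson-like
variance by static decorrelation at small packing. No ergodicity, no kinetic limit. [difficulty: XL]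
[ErpenbeckWood1984, PulvirentiTsagkarogiannis2012, LebowitzPenrose1964, Ruelle1969, GST2013]
#9 HomogeneousInvariance (support) — Shared verbatim with OneParticleInfluence.HomogeneousInvariance
(stmt-AtomisticToContinuum-3073): the canonical Gibbs law with constant profiles (activity c, drift
u_c, temperature θ_c) is invariant under every hard-sphere flow at every time (Liouville measure
preserved + kinetic energy and momentum conserved on the good set; both sides are the zero measure
when the partition function vanishes). Input (ii) of VirialEOS and the A = 0 case of X_A.
[difficulty: provable-now] [GST2013, Spohn1991]

TWO-LAYER PLAN. Foreseen glued splits (none filed now; k ≤ 3, depth 1): FrozenCoercivity ⇐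
MeanTensorDecay (E_P[K°(t)] → 0: the coercivity inequality dE[K°]/dt ≤ −c N^{1/3} E[K°] + o(1) from
contact statistics of a translation-invariant law) → TensorConcentration (Var_P of the empirical
tensor → 0) → FrozenCoercivity. ContactThermalisation ⇐ FrozenMaxwellisation (one-body velocity law
→ M_θ̄ in probability, bounded continuous test functions) → PairContactLaw (Palm law of (relative
velocity, impact vector) over collisions in [t,t+τ] → Enskog flux measure at (σ,θ̄)) →
ContactThermalisation. VirialEOS ⇐ ContactTheoremCanonical (static, steps (i)) → CollisionVirialLLN
(steps (ii)–(iii)) → VirialEOS. After ObjectiveHardSphereFlow lands: HomoenergeticAdiabat ⇐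
OneTensorCoercivityA (C_coll° = −ν_eff T° + o(N^{1/3}|T°|), ν_eff ≥ cN^{1/3}, under driving) →
CollisionalPressureLocalityA ((P) under driving at the instantaneous (ρ(t), θ(t))) →
HomoenergeticAdiabat, the glue being the exact energy identity de_th/dt = −(V/N)E[Π_N]:D plus
Gronwall (supports OneTensorBalance, PassiveHeating).

KILL CRITERIA. (a) FrozenCoercivity refuted (Theorems/*Refutation: a positive-P_N-measure set from
Gibbs positions × Gaussian velocities whose kinetic tensor stays anisotropic at a fixed t > 0 as N →
∞) ⇒ close --reason refuted:FrozenCoercivity — and it refutes in substance every local-equilibrium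
closure on the board, a first-rank negative for the conjunct. (b) ContactThermalisation refuted with
FrozenCoercivity standing ⇒ collisional pressure is history-dependent at Euler order: restate (P)
with the measured non-equilibrium contact density and pivot X_A to "adiabat with renormalised Z" —
informative, route survives one restate. (c) VirialEOS refuted ⇒ either hsCompressibility-as-defined
is junk at small σ (a Literature definition issue: restate with the cluster-expansion Z) or the
contact theorem fails on the torus canonical ensemble — check which before any pivot. (d)
HomoenergeticAdiabat refuted for some A after typing (order-one heating above the adiabat at Euler
scaling) ⇒ close refuted; hand the witness to FirstFailureBlowup/ImplosionLoophole as evidence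
against the conjunct for affine zoomed data. (e) Mooted if a sibling route proves FluxClosure (0823)
in a translation-invariant form implying (K),(P) — then close superseded.

NOT DECOMPOSED YET. Deliberately not items at open: full Maxwellisation of the one-body law
(stronger than (K); layer 2), general non-axis-aligned covariance and non-zero drift
(Galilean/cubic-symmetry bookkeeping), RATES (e^{−cN^{1/3}t} decay, the honest content of
"coercivity"), the collision-count clock numCollisions/(N+1)^{4/3} → 3t(Z−1)√θ/(σ√π) (VirialEOS's
sibling; same proof), the contact theorem as a stand-alone static lemma, and everything on the
deforming cell: HomoenergeticAdiabat (crux 4, informal), the exact SLLOD tensor balance dT/dt =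
−(BT+TBᵀ)+C_coll and energy theorem (support OneTensorBalance), the finite-N passivity identity
H(f_t|ψ_t^{ad})/N = (3/2)(θ_true−θ_ad)/θ_ad ≥ 0 (support PassiveHeating) — all filed as informal
items after open, typed when the definition request ObjectiveHardSphereFlow lands. The card's
alternative engine E1 (fixed-N slow deformation: Simányi ergodicity on SKEW flat tori +
Kasuga/Anosov averaging with impacts ⇒ finite-N adiabat; then dimension-uniformity) is a different
decomposition of HomoenergeticAdiabat and would be a separate route sharing that decl; it is not
filed here (Kasuga1961, Simanyi2013: cubic torus only). Transfer rung → conjunct (zoom to locally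
affine data / objective-MD cells replacing pistons) is recorded, not claimed.

CHEAPEST FALSIFIER. (i) Event-driven MD, N = 10⁴–10⁶, packing πσ³/6 ∈ [0.05, 0.2], uniform positions
+ Gaussian velocities with θ = (2, ½, ½): the traceless kinetic tensor must relax within a few mean
free times at an N-INDEPENDENT rate in kinetic units (∝ N^{1/3} in macroscopic units), and the
post-relaxation collisional virial must equal Z_CS(πσ³/6) − 1 within noise — the equilibrium half is
ErpenbeckWood1984 (Z from collision rates vs Carnahan–Starling to ~10⁻³), already passed
numerically; a surviving anisotropy or an N-drifting rate kills FrozenCoercivity. (ii) SLLOD /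
Kraynik–Reinelt NEMD of hard spheres at reduced shear rate γ* = γ̇τ_coll ∈ [10⁻³, 10⁻¹] and
homogeneous compression at the same reduced rates: excess heating over the adiabat and normal-stress
differences must be O(γ*) (Erpenbeck1984: linear regime below γ* ≈ 0.1; the string phase lives at γ*
= O(1), outside Euler scaling where γ* ≍ N^{-1/3}). (iii) Lookup: a theorem Maxwellising N
deterministic hard spheres at fixed packing over one mean free time would downgrade FrozenCoercivity
(none found: Kac/Mischler–Mouhot stochastic, Lanford/BGSSCPAM2023 Boltzmann–Grad). Not run here (no
kit; lit daemon down at filing).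

NUMBERS. Scaling: n = N+1 per unit volume, ε_N = σ(N+1)^{-1/3}, nε² = σ²(N+1)^{1/3}, nε³ = σ³
(reduced density), packing η = πσ³/6. Enskog collision frequency per particle ν = 4nε²χ√(πθ) =
(N+1)^{1/3}·4σ²χ√(πθ); total collisions in [0,t] ≈ (N+1)^{4/3}·2σ²χ√(πθ)·t; flux-weighted mean
impulse per collision ε√(πθ); virial: Z − 1 = (3Nθτ)⁻¹ Σ_coll ε|w·ω| = (2π/3)σ³χ (consistency check
of the constant 6 in (P): ε·Σ_collΣᵢ‖Δvᵢ‖ = 2Σ_coll ε|w·ω|). Carnahan–Starling χ = (1−η/2)/(1−η)³,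
Z_CS = (1+η+η²−η³)/(1−η)³; second virial Z = 1 + 4η + O(η²) matches hsCompressibility's docstring Z
= 1 + (2π/3)σ³ + O(σ⁶). Mean free path ℓ = 1/(√2πnε²χ) = N^{-1/3}/(√2πσ²χ) ⇒ Kn ≍ N^{-1/3}; Enskog
shear viscosity η_s = O(√θ/ε²)·(density corrections) ⇒ kinematic viscosity/(sound speed × length) =
O(Kn). Homoenergetic kinematics: B(t) = A(I+tA)⁻¹, Ḃ = −B², ρ(t) = ρ₀/det(I+tA), t*(A) = first zero
of det(I+tA) (= ∞ for simple shear A² = 0); ideal-gas check: c(t) = (I+tA)⁻¹c(0), tensor temperature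
θ₀(I+tA)⁻¹(I+tA)⁻ᵀ ≥ adiabat θ₀det(I+tA)^{-2/3}·𝟙 in trace by AM–GM, equality iff conformal — the σ
= 0 failure of X_A, as it must be.

DEFINITION REQUESTS. (1) ObjectiveHardSphereFlow (A : Matrix (Fin 3) (Fin 3) ℝ) σ N — Dayal–James
objective MD for hard spheres: N+1 spheres of diameter hsDiameter σ N in the deforming cell
ℝ³/(I+tA)ℤ³ for t < t*(A); cleanest (Lagrangian) form: one-particle phase space (ℝ³×ℝ³)/Λ_A with the
STATIC lattice Λ_A = {(n, An) : n ∈ ℤ³}, state (gᵢ, vᵢ) = (xᵢ − tvᵢ, vᵢ) constant between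
collisions, contact of (i, j) through image n at time s iff |gᵢ − gⱼ − n + s(vᵢ − vⱼ − An)| = ε,
elastic jump with relative velocity vᵢ − vⱼ − An (both g and v jump); equivalently SLLOD form on 𝕋³
with flat metric (I+tA)ᵀ(I+tA) and peculiar velocities ċ = −B(t)c. Package as a hypothesis structure
like HardSphereFlow (two-time flow maps, good set, Liouville preservation in (x,v)), plus
objectiveGibbsLaw (canonical data at θ₀) and the peculiar kinetic tensor; existence (Alexander-type)
is a separate CONSTRUCTION statement, never a field. Why it cannot be an instance of HardSphereFlow
over some Kinetic.Geometry: image copies carry velocity offsets An that reflectVel cannot see, and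
in cell coordinates free flight is parabolic. For: HomoenergeticAdiabat, OneTensorBalance,
PassiveHeating (filed after open). Topic: Literature/Analysis/FluidPDE (next to HardSphereDynamics).
(2) Cite fact wanted (not load-bearing): JamesNotaVelazquez2019 collision-dominated theorem
(homoenergetic Boltzmann solutions → Maxwellian with the Hilbert-expansion temperature law) as a
named fact in Literature/MathematicalPhysics/KineticTheory — the kinetic cross-check of X_A.

Novelty: Searches (2026-08-15): `lit search` ×4 (local FTS daemon DOWN — ConnectionResetError on every call;
openalex/arxiv/s2 cascade HTTP 429), `lit search --source crossref "hard sphere pressure collision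
rate virial theorem rigorous"` (6 hits: virial-coefficient and colloid papers, nothing
dynamical-rigorous), `lit galaxy search "objective molecular dynamics" --star all` (4 pdf hits;
relevant: arXiv:2506.15449 Miele–Nota–Velázquez 2025, Rayleigh–Boltzmann with shear deformations,
hyperbolic-dominated — the JNV programme is alive and still kinetic), `lit papers --grep
"homoenerg|SLLOD|Lees.Edwards|objective molecular|Enskog"` (0 of 376 held), `lit cite` for 8 DOIs
(bib entries added: DayalJames2010, JamesNotaVelazquez2018, JamesNotaVelazquez2019,
JamesNotaVelazquez2020, Erpenbeck1984, PuszWoronowicz1978, KraynikReinelt1992, Kasuga1961),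
references.bib grep (EvansMorriss2008, ErpenbeckWood1984, PulvirentiTsagkarogiannis2012,
VanbeijerenErnst1973, Resibois1978, Simanyi2013 present), the board: 135 idea cards of the sub + all
8 route files (HomogeneousInvariance 3073 found and shared; no typed homogeneous-relaxation,
collision-count or collisional-virial statement exists; related mechanisms:
stiff-relaxation-collisional-coercivity K1, warm-isotropises-cold-is-priced cruxes 1–2,
maxwellian-clt-collision-isometries, athermal-clock-ward-identity, boltzmann-breathing-mode-clock),
`ledger negatives` (0).
Nearest prior art found: DayalJames2010 (doi:10.1016/j.jmps.2009.10.008 — deforming pe  [refs: 10.1016/j.jmps.2009.10.008, 10.1007/s00332-019-09535-6, 2506.15449, doi:10.1016/j.jmps.2009.10.008, doi:10.1007/s00332-019-09535-6, DayalJames2010, JamesNotaVelazquez2018, JamesNotaVelazquez2019, JamesNotaVelazquez2020, Erpenbeck1984, PuszWoronowicz1978, KraynikReinelt1992, Kasuga1961, EvansMorriss2008, ErpenbeckWood1984, PulvirentiTsagkarogiannis2012, VanbeijerenErnst1973, Resibois1978, Simanyi20]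

Barriers (technique_class: objective-md, homogeneous-rung, virial-clock): - technique_class: objective-md, homogeneous-rung, virial-clock
- Literature.Barriers.AtomisticToContinuum.BoltzmannHypothesisBarrierNarrow: NOT evaded for
FrozenCoercivity / ContactThermalisation — they ARE flux-level closure statements ("what the method
consumes") in their most symmetric instance; the bet is that translation invariance in law, Gibbs
positional data and a single tensor observable make the closure attackable directly on the torus as
N → ∞, with no infinite-volume stationary state and no classification ever formed. The barrier's
formal kernel is exactly the σ = 0 failure of FrozenCoercivity (anisotropic (Haar⊗h)^{⊗N} is
free-flight stationary), so the statement has teeth. VirialEOS evades it honestly (equilibrium law,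
stationarity, sub-mean-free-time locality only).
- Literature.Barriers.AtomisticToContinuum.BoltzmannHypothesisBarrier: as above; no entropy method,
no one-block/two-block step is used anywhere in the route.
- Literature.Barriers.AtomisticToContinuum.DiluteRegimeBarrierNarrow: applies head-on to both cruxes
(fixed σ, times ≫ mean free time, no Boltzmann–Grad or joint dilute limit) and is not evaded — the
route does not pass through any kinetic equation; it is evaded by VirialEOS (no kinetic time scale
is crossed: windows h_N ≪ N^{-1/3}).
- Literature.Barriers.AtomisticToContinuum.DiluteRegimeBarrier: same status as the narrowed version.
- Literature.Barriers.AtomisticToContinuum.HighMomentumCutoffBarrierNarrow: moot — only second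
velocity moments

History (route lifecycle, newest last):
- 2026-08-15T13:43:16Z · CLOSED retired — not-a-thesis: assembly does not conclude the sub-problem Statement (operator:999:1257524)

sub-problem: HydrodynamicLimit · status: closed(retired) · opened planner-plancard-AtomisticToContinuum-Hydrody-4db4b35a-0 2026-08-15T11:41:35Z · rev 0 · ledger route-AtomisticToContinuum-HomoenergeticRung
GENERATED by the gate from the ledger (D-0016/17). Provers cite these decls: `theorem foo : Summit.AtomisticToContinuum.HydrodynamicLimit.Theses.HomoenergeticRung.<Decl> := …` in Summits/AtomisticToContinuum/HydrodynamicLimit/Theorems/<Name>.lean.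
-/

namespace Summit.AtomisticToContinuum.HydrodynamicLimit.Theses.HomoenergeticRung

open scoped BigOperators Topology Manifold Classical MeasureTheory ProbabilityTheory Matrix InnerProductSpace ComplexConjugate ContinuousMap
open Filter Set Function TopologicalSpace MeasureTheory

attribute [summit_statement] _root_.HydrodynamicLimit

/-- item stmt-AtomisticToContinuum-5560 · target · rank 0 · closed · moot by None · by planner
why it might fail: Conjunction of FrozenCoercivity and ContactThermalisation, fails with either; also the target value hsCompressibility = 1 + η·deriv f_ex (limsup/deriv junk) is the honest Z only where f_ex is differentiable — expected at all small σ (LebowitzPenrose1964) but part of the claim.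
sources: DayalJames2010, JamesNotaVelazquez2019, ErpenbeckWood1984, Spohn1991
[target] X₀ above: for σ < σ₀, every axis temperature vector θ > 0 and every family of hard-sphere
flows, the laws P_N = particleLaw(canonicalDensity of 𝟙_{hard core}·∏ exp(−v_k²/2θ_k)) are
probability measures and for every t > 0: (K) all entries of the empirical kinetic tensor at time t
converge in probability to θ̄δ_kl, and (P) for every τ > 0 the normalised collisional virial over
[t, t+τ] converges in probability to hsCompressibility(σ³) − 1. -/
@[route_item "route-AtomisticToContinuum-HomoenergeticRung"]
def FrozenRung : Prop :=
  open Literature.MathematicalPhysics.KineticTheory Literature.Analysis.FluidPDE MeasureTheory Filter Topology in ∃ σ₀ : ℝ, 0 < σ₀ ∧ ∀ σ : ℝ, 0 < σ → σ < σ₀ → ∀ θ : Fin 3 → ℝ, (∀ k, 0 < θ k) → ∀ Φ : (N : ℕ) → HardSphereFlow (Torus.geometry (Fin 3)) (hsDiameter σ N) (N + 1), let P : (N : ℕ) → Measure (Config (N + 1) (Fin 3) T3) := fun N => particleLaw (Φ N) (canonicalDensity (Torus.geometry (Fin 3)) (hsDiameter σ N) (N + 1) (fun y => Real.exp (-(∑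 k, (y.2 k) ^ 2 / (2 * θ k))))); (∀ N, IsProbabilityMeasure (P N)) ∧ ∀ t : ℝ, 0 < t → (∀ (k l : Fin 3) (δ : ℝ), 0 < δ → Tendsto (fun N => P N {z | δ < |(∫ y, y.2 k * y.2 l ∂(empiricalMeasure ((Φ N).flow t z))) - (if k = l then (θ 0 + θ 1 + θ 2) / 3 else 0)|}) atTop (𝓝 0)) ∧ (∀ τ : ℝ, 0 < τ → ∀ δ : ℝ, 0 < δ → Tendsto (fun N => P N {z | δ < |hsDiameter σ N / (6 * ((θ 0 + θ 1 + θ 2) / 3) * τ * ((N : ℝ) + 1)) * (∑ᶠ s ∈ collisionTimes (Torus.geometry (Fin 3)) (hsDiameter σ N) (fun r => (Φ N).flow r z) ∩ Set.Icc t (t + τ), ∑ i, ‖((Φ N).flow s z i).2 - (Function.leftLim (fun r => (Φ N).flow r z) s i).2‖) - (hsCompressibility (σ ^ 3) - 1)|}) atTop (𝓝 0))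

/-- item stmt-AtomisticToContinuum-5561 · crux · rank 2 · closed · moot by None · by planner
why it might fail: Needs control of deterministic hard spheres at FIXED reduced density over ≍N^{1/3}t collision times; not even one mean free time is covered by a Lanford-type theorem there (DiluteRegimeBarrier). False if a positive-measure anisotropy-keeping class (lanes/rows) is reachable from Gibbs positions.
sources: Spohn1991, JamesNotaVelazquez2019, GST2013, BGSSCPAM2023, Literature.Barriers.AtomisticToContinuum.BoltzmannHypothesisBarrierNarrow, Literature.Barriers.AtomisticToContinuum.DiluteRegimeBarrierNarrow
[crux] (K) alone — ONE-TENSOR COERCIVITY, frozen (A = 0) form of the card's crux E2: from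
hard-core-uniform positions × anisotropic Gaussian velocities (θ₀,θ₁,θ₂), at fixed reduced density σ
< σ₀ and every macroscopic t > 0, N⁻¹Σᵢ v_{i,k}v_{i,l}(t) → θ̄δ_kl in probability, θ̄ = (θ₀+θ₁+θ₂)/3
(collisions destroy velocity anisotropy at rate ≍ N^{1/3}; the ideal gas σ = 0 is the exact
counterexample: the anisotropic state is stationary under free flight, BoltzmannHypothesis kernel).
[difficulty: open-problem] -/
@[route_item "route-AtomisticToContinuum-HomoenergeticRung"]
def FrozenCoercivity : Prop :=
  open Literature.MathematicalPhysics.KineticTheory Literature.Analysis.FluidPDE MeasureTheory Filter Topology in ∃ σ₀ : ℝ, 0 < σ₀ ∧ ∀ σ : ℝ, 0 < σ → σ < σ₀ → ∀ θ : Fin 3 → ℝ, (∀ k, 0 < θ k) → ∀ Φ : (N : ℕ) → HardSphereFlow (Torus.geometry (Fin 3)) (hsDiameter σ N) (N + 1), let P : (N : ℕ) → Measure (Config (N + 1) (Fin 3) T3) := fun N => particleLaw (Φ N) (canonicalDensity (Torus.geometry (Fin 3)) (hsDiameter σ N) (N + 1) (fun y => Real.exp (-(∑ k, (y.2 k) ^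 2 / (2 * θ k))))); (∀ N, IsProbabilityMeasure (P N)) ∧ ∀ t : ℝ, 0 < t → ∀ (k l : Fin 3) (δ : ℝ), 0 < δ → Tendsto (fun N => P N {z | δ < |(∫ y, y.2 k * y.2 l ∂(empiricalMeasure ((Φ N).flow t z))) - (if k = l then (θ 0 + θ 1 + θ 2) / 3 else 0)|}) atTop (𝓝 0)

/-- item stmt-AtomisticToContinuum-5562 · crux · rank 3 · closed · moot by None · by planner
why it might fail: A two-body contact statistic: needs the pair law at contact (rate ∝ χ(σ³), Maxwellian flux impulse law at θ̄), strictly more than one-body isotropy; at fixed σ excluded-volume correlations built during relaxation could leave an O(1) non-equilibrium contact density (history-dependent collision rate).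
sources: ErpenbeckWood1984, VanbeijerenErnst1973, Resibois1978, Spohn1991, EvansMorriss2008
[crux] (P) for the same anisotropic data — after any t > 0 the two-body CONTACT statistics are the
equilibrium ones at (σ, θ̄): the collisional virial ε_N Σ_{s ∈ collisionTimes ∩ [t,t+τ]} Σᵢ ‖vᵢ(s) −
vᵢ(s⁻)‖ /(6 θ̄ τ (N+1)) → Z(σ³) − 1 in probability (collision rate = Enskog rate 4nε²χ√(πθ̄) with χ
= 3(Z−1)/(2πσ³) AND mean impulse √(πθ̄) per collision); frozen form of the card's "collisional
pressure takes its local-equilibrium value", i.e. zero Euler-order bulk-viscous pressure excess.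
[deps: FrozenCoercivity] [difficulty: open-problem] -/
@[route_item "route-AtomisticToContinuum-HomoenergeticRung"]
def ContactThermalisation : Prop :=
  open Literature.MathematicalPhysics.KineticTheory Literature.Analysis.FluidPDE MeasureTheory Filter Topology in ∃ σ₀ : ℝ, 0 < σ₀ ∧ ∀ σ : ℝ, 0 < σ → σ < σ₀ → ∀ θ : Fin 3 → ℝ, (∀ k, 0 < θ k) → ∀ Φ : (N : ℕ) → HardSphereFlow (Torus.geometry (Fin 3)) (hsDiameter σ N) (N + 1), let P : (N : ℕ) → Measure (Config (N + 1) (Fin 3) T3) := fun N => particleLaw (Φ N) (canonicalDensity (Torus.geometry (Fin 3)) (hsDiameter σ N) (N + 1) (fun y => Real.exp (-(∑ k, (y.2 k) ^ 2 / (2 * θ k))))); (∀ N, IsProbabilityMeasure (P N)) ∧ ∀ t : ℝ, 0 < t → ∀ τ : ℝ, 0 < τ → ∀ δ : ℝ, 0 < δ → Tendsto (fun N => P N {z | δ < |hsDiameter σ N / (6 * ((θ 0 + θ 1 + θ 2) / 3) * τ * ((N : ℝ) + 1)) * (∑ᶠ s ∈ collisionTimes (Torus.geometry (Fin 3)) (hsDiameter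 σ N) (fun r => (Φ N).flow r z) ∩ Set.Icc t (t + τ), ∑ i, ‖((Φ N).flow s z i).2 - (Function.leftLim (fun r => (Φ N).flow r z) s i).2‖) - (hsCompressibility (σ ^ 3) - 1)|}) atTop (𝓝 0)

-- item stmt-AtomisticToContinuum-6804 · support · rank 4 · closed · moot by None · by planner — informal only, no Lean statement yet:
--   [crux] HOMOENERGETIC ADIABAT (X_A, the card's rung proper; typed once the definition request
--   ObjectiveHardSphereFlow lands). For every A : Matrix (Fin 3) (Fin 3) ℝ with t*(A) := inf{t > 0 :
--   det(I+tA) = 0} (= +∞ if none), every σ < σ₀ and θ₀ > 0: N+1 hard spheres of diameter hsDiameter σ N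
--   in the Dayal–James objective-MD cell ℝ³/(I+tA)ℤ³ (exact wall-free invariant manifold of Newtonian
--   dynamics; homoenergetic Euler flow u = B(t)x, B = A(I+tA)⁻¹, ρ(t) = 1/det(I+tA)), started from
--   canonical Gibbs data at temperature θ₀, satisfy for every t < t*(A): the empirical PECULIAR kinetic
--   tensor (N+1)⁻¹Σᵢ

/-- item stmt-AtomisticToContinuum-3073 · support · rank 9 · closed · moot by None · by planner
sources: GST2013, Spohn1991
[support] the canonical law with CONSTANT profiles (c, ū, θ̄) is invariant under every hard-sphere
flow, lawAt Φ p t = p: its density 1_D Π_i M_{ū,θ̄}(v_i)/Z is a function of kinetic energy and total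
momentum; Liouville preservation (HardSphereFlow.measurePreserving), energy conservation
(IsHardSphereTrajectory.configEnergy_eq_holds), momentum conservation (configMomentum_freeFlight /
configMomentum_collidePair along isTrajectory), invariance of the good set. Gives E_{p_0}[F_t] =
E_{p_0}[F_0] at the κ = 0 end of the homotopy; rests on PROVED cone facts. [difficulty:
provable-now] -/
@[route_item "route-AtomisticToContinuum-HomoenergeticRung"]
def HomogeneousInvariance : Prop :=
  ∀ (σ c θc : ℝ) (uc : Literature.MathematicalPhysics.KineticTheory.V3), 0 < σ → 0 < c → 0 < θc → ∀ (N : ℕ) (Φ : Literature.Analysis.FluidPDE.HardSphereFlow (Literature.Analysis.FluidPDE.Torus.geometry (Fin 3)) (Literature.MathematicalPhysics.KineticTheory.hsDiameter σ N) (N + 1)) (t : ℝ), Φ.lawAt (Literature.MathematicalPhysics.KineticTheory.localGibbsLaw σ (fun _ => c) (fun _ => uc) (fun _ => θc) N Φ) t = Literature.MathematicalPhysics.KineticTheory.localGibbsLaw σ (fun _ => c) (fun _ => uc) (fun _ => θc) N Φ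

/-- item stmt-AtomisticToContinuum-5563 · support · rank 9 · closed · moot by None · by planner
sources: ErpenbeckWood1984, PulvirentiTsagkarogiannis2012, LebowitzPenrose1964, Ruelle1969, GST2013
[support] The θ₀ = θ₁ = θ₂ (canonical Gibbs, localGibbsLaw with constant profiles 1, 0, θ) case of
(P) from time 0: under the flow-invariant equilibrium law the normalised collisional virial over
[0,T] converges in probability to hsCompressibility(σ³) − 1 — the virial/contact theorem realised
DYNAMICALLY (ErpenbeckWood1984's MD estimator of Z as a theorem). Intended proof: (i) finite-N
scaling identity ∂_ε log(free volume) = −(contact surface measure) and canonical cluster expansion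
uniform in N (PulvirentiTsagkarogiannis2012) ⇒ contact value → 3(Z−1)/(2πσ³) with Z = 1 + η f_ex′(η)
analytic at small η (LebowitzPenrose1964, Ruelle1969 §3.4); (ii) E[virial] exact by stationarity
(HomogeneousInvariance) + Rice/flux formula on the contact set; (iii) variance: slice [0,T] into
windows h_N with N^{-4/3} ≪ h_N ≪ N^{-1/3}; Cauchy–Schwarz across windows reduces to the relative
variance of ONE sub-mean-free-time window, where collision events are local functionals of the
initial Gibbs configuration up to geometrically small collision-chain corrections ⇒ Poisson-like
variance by static decorrelation at small packing. No ergodicity, no kinetic limit. [difficulty: XL] -/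
@[route_item "route-AtomisticToContinuum-HomoenergeticRung"]
def VirialEOS : Prop :=
  open Literature.MathematicalPhysics.KineticTheory Literature.Analysis.FluidPDE MeasureTheory Filter Topology in ∃ σ₀ : ℝ, 0 < σ₀ ∧ ∀ σ : ℝ, 0 < σ → σ < σ₀ → ∀ θ : ℝ, 0 < θ → ∀ Φ : (N : ℕ) → HardSphereFlow (Torus.geometry (Fin 3)) (hsDiameter σ N) (N + 1), (∀ N, IsProbabilityMeasure (localGibbsLaw σ (fun _ => 1) (fun _ => 0) (fun _ => θ) N (Φ N))) ∧ ∀ T : ℝ, 0 < T → ∀ δ : ℝ, 0 < δ → Tendsto (fun N => localGibbsLaw σ (fun _ => 1) (fun _ => 0) (fun _ => θ) N (Φ N) {z | δ < |hsDiameter σ N / (6 * θ * T * ((N : ℝ) + 1)) * (∑ᶠ s ∈ collisionTimes (Torus.geometry (Fin 3)) (hsDiameter σ N) (fun r => (Φ N).flow r z) ∩ Set.Icc 0 T, ∑ i, ‖((Φ N).flow s z i).2 - (Function.leftLim (fun r => (Φ N).flow r z) s i).2‖) - (hsCompressibility (σ ^ 3) - 1)|}) atTop (𝓝 0)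

-- item stmt-AtomisticToContinuum-6820 · support · rank 9 · closed · moot by None · by planner — informal only, no Lean statement yet:
--   [support] PASSIVE HEATING (exact finite-N identity + sign; typed once ObjectiveHardSphereFlow
--   lands). In the setting of HomoenergeticAdiabat let f_t be the law at time t (cell coordinates,
--   peculiar momenta) and ψ_t the canonical Gibbs law on the time-t cell at the temperature θ_ad^N(t)
--   that keeps the Gibbs–Shannon entropy S(ψ_t) = S(ψ_0) (finite-N adiabat). Then for every N and t <
--   t*(A): H(f_t | ψ_t) = (N+1)·(3/2)·(θ_true(t) − θ_ad^N(t))/θ_ad^N(t) ≥ 0, where (3/2)θ_true(t) :=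
--   E_{f_t}[peculiar kinetic energy]/(N+1). Proof: Liouville (S(f_t) = S(f_0) = S(ψ_0) = S(ψ_t)) and
--   −log ψ_t = log Z_t +

-- item stmt-AtomisticToContinuum-6822 · support · rank 9 · closed · moot by None · by planner — informal only, no Lean statement yet:
--   [support] ONE-TENSOR BALANCE AND ENERGY THEOREM (exact identities; typed once
--   ObjectiveHardSphereFlow lands). In the setting of HomoenergeticAdiabat, with T_N(t) := (N+1)⁻¹Σᵢ
--   cᵢ⊗cᵢ the empirical peculiar kinetic tensor and B = A(I+tA)⁻¹ (so Ḃ = −B²): (i) between collisions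
--   ċᵢ = −Bcᵢ, hence pathwise on the good set T_N(t) − T_N(s) = −∫ₛᵗ(B T_N + T_N Bᵀ) + Σ_{collisions in
--   (s,t]} Δ_coll T_N, where at a collision of (i,j) through image n with unit normal ω and relative
--   velocity w = cᵢ − cⱼ + εBω the jump is Δ(cᵢ⊗cᵢ + cⱼ⊗cⱼ) with cᵢ′ = cᵢ − (w·ω)ω, cⱼ′ = cⱼ + (w·ω)ω;
--   (ii) energy theorem: (1/2)tr o

/-- item stmt-AtomisticToContinuum-5564 · assembly · rank 1 · closed · moot by None · by planner
sources: DayalJames2010, Spohn1991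
[assembly] FrozenCoercivity → ContactThermalisation → FrozenRung (σ₀ := min; pure logic, proved in
Sketch.lean). -/
@[route_item "route-AtomisticToContinuum-HomoenergeticRung"]
def Assembly : Prop :=
  FrozenCoercivity → ContactThermalisation → FrozenRung

end Summit.AtomisticToContinuum.HydrodynamicLimit.Theses.HomoenergeticRung
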